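import Summits.KontsevichZagierPeriods.KontsevichZagierPeriods.Theorems.FermatIsogenyDeepWordSectorBP7
import Literature.NumberTheory.Transcendental.KontsevichZagierGammaProofs

/-!
# FermatIsogeny deep targets — C-file v2: Chudnovsky discharged from the tree — LEVELS 3 AND 4 HYPOTHESIS-FREE, LEVEL 6 AND CRUX 3898's
# BASE RANGE MODULO THE LINEAR RUNG ONLY (decomp-kz · lens-5 · g22 · addenda 4–6; critic g6-19 finding, critic g7 repair STATUS l.1397)

`Literature.NumberTheory.Transcendental.KontsevichZagierGammaProofs` is served by the farm since 2026-08-31T00:27Z (critic g7); this body is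
CHECKED in the lens probe `scratch/ProbeB5C.lean` (= ProbeB5 + that import + this body + axiom pins).  v1 @ae35ac37 did not elaborate
(`convert h using 1` left `… ∘ ⇑(Equiv.swap 0 1)`); the two discharge proofs below are the critic's certified repair, transcribed.
LANDER: adjust the first import to the landed B-file module name.  When `Summits…Theorems.FermatIsogenyBetaLinearSectorSixthsMax` builds
(today rc 75 `remote:stale:332:unbuilt:…TerasomaMultiplicationBetaCancellationEulerTerms`), add
`theorem betaLinearSixths_holds : BetaLinearSixths := BetaLinearSector.SixthsMax.betaLinearSector_sixths` and drop the `h6` binders.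
-/

noncomputable section

namespace Summit.KontsevichZagierPeriods.FermatIsogeny.DeepTargets

open Literature.NumberTheory.Transcendental
open Summit.KontsevichZagierPeriods.KontsevichZagierPeriods.Theses.FermatIsogeny (BetaProductSector)

/-- Chudnovsky 1976 for `Γ(⅓), π` — the TREE THEOREM `algebraicIndependent_real_pi_gamma_one_third` up to the order of the pair
(proof shape: critic g7, STATUS l.1397). (cite Waldschmidt2006, Thm 14) -/
theorem chudnovskyGammaThird_holds : ChudnovskyGammaThird := by
  have h := (algebraicIndependent_real_pi_gamma_one_third).comp (Equiv.swap (0 : Fin 2) 1) (Equiv.injective _)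
  have e : (![Real.Gamma ((1:ℝ)/3), Real.pi] : Fin 2 → ℝ) = ![Real.pi, Real.Gamma (1 / 3)] ∘ ⇑(Equiv.swap (0 : Fin 2) 1) := by
    funext i; fin_cases i <;> simp [Equiv.swap_apply_left, Equiv.swap_apply_right]
  unfold ChudnovskyGammaThird; rw [e]; exact h

/-- Chudnovsky 1976 for `Γ(¼), π` — the TREE THEOREM `algebraicIndependent_real_pi_gamma_one_quarter` up to the order of the pair.
(cite Waldschmidt2006, Thm 14) -/
theorem chudnovskyGammaQuarter_holds : ChudnovskyGammaQuarter := by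
  have h := (algebraicIndependent_real_pi_gamma_one_quarter).comp (Equiv.swap (0 : Fin 2) 1) (Equiv.injective _)
  have e : (![Real.Gamma ((1:ℝ)/4), Real.pi] : Fin 2 → ℝ) = ![Real.pi, Real.Gamma (1 / 4)] ∘ ⇑(Equiv.swap (0 : Fin 2) 1) := by
    funext i; fin_cases i <;> simp [Equiv.swap_apply_left, Equiv.swap_apply_right]
  unfold ChudnovskyGammaQuarter; rw [e]; exact h

/-- `GammaThirdPiIndep`, hypothesis-free. [this work] -/
theorem gammaThirdPiIndep_holds : GammaThirdPiIndep := gammaThirdPiIndep_of_chudnovsky chudnovskyGammaThird_holds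

/-- **LEVEL 3 OF EVERY BETA-WORD SECTOR, hypothesis-free.** [this work] -/
theorem betaWordSectorLevel_three (k : ℕ) : BetaWordSectorLevel k 3 :=
  betaWordSectorLevel_three_of_chudnovsky chudnovskyGammaThird_holds k

/-- **LEVEL 4 OF EVERY BETA-WORD SECTOR, hypothesis-free.** [this work] -/
theorem betaWordSectorLevel_four (k : ℕ) : BetaWordSectorLevel k 4 :=
  betaWordSectorLevel_four_of_chudnovsky chudnovskyGammaQuarter_holds k

/-- Level 4 box = its same-type chains, hypothesis-free. [this work] -/
theorem betaWordSectorLevel_four_iff' (k : ℕ) : BetaWordSectorLevel k 4 ↔ BoxChain k 4 (SameType 4) :=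
  betaWordSectorLevel_four_iff_of_chudnovsky chudnovskyGammaQuarter_holds k

/-- Level 6 box = its same-type chains, hypothesis-free. [this work] -/
theorem betaWordSectorLevel_six_iff' (k : ℕ) : BetaWordSectorLevel k 6 ↔ BoxChain k 6 (SameType 6) :=
  (betaWordSectorLevel_three_six_iff_of_chudnovsky chudnovskyGammaThird_holds k).2

/-- **Crux 3898, hypothesis-free form of the base range**: `BetaProductSector ⟺ BoxChain 2 6 (SameType 6) ∧ (levels N = 5 and N ≥ 7)`.
[this work] -/
theorem betaProductSector_iff_level_six :
    BetaProductSector ↔ (BoxChain 2 6 (SameType 6) ∧ ∀ N, 3 ≤ N → N ≠ 3 → N ≠ 4 → N ≠ 6 → BetaWordSectorLevel 2 N) :=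
  betaProductSector_iff_level_six_of_chudnovsky chudnovskyGammaThird_holds chudnovskyGammaQuarter_holds

/-- **LEVEL 6 OF EVERY BETA-WORD SECTOR modulo the route's linear rung only** (`BetaLinearSixths` = the statement of the tree theorem
`BetaLinearSector.SixthsMax.betaLinearSector_sixths`, whose module awaits a farm build; then `exact betaLinearSector_sixths`). [this work] -/
theorem betaWordSectorLevel_six_of_linear (h6 : BetaLinearSixths) (k : ℕ) : BetaWordSectorLevel k 6 :=
  betaWordSectorLevel_six_of_chudnovsky_linear chudnovskyGammaThird_holds h6 k

/-- **Crux 3898 = its pure Rohrlich shadow range `N = 5, N ≥ 7`, modulo the linear rung only.** [this work] -/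
theorem betaProductSector_iff_shadow_of_linear (h6 : BetaLinearSixths) :
    BetaProductSector ↔ ∀ N, 5 ≤ N → N ≠ 6 → BetaWordSectorLevel 2 N :=
  betaProductSector_iff_shadow_five_seven chudnovskyGammaThird_holds chudnovskyGammaQuarter_holds h6

end Summit.KontsevichZagierPeriods.FermatIsogeny.DeepTargets
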